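import Summits.BirchSwinnertonDyer.BirchSwinnertonDyer.Theorems.AdditiveBranchIMCGordTwoRankZeroCompanionRecord71148bh1
import Summits.BirchSwinnertonDyer.Rank1Residual.Supersingular.X7SevenCongruenceCertificatesRev
import HarnessLib

/-!
# `71148bh1 @ 7` — the companion/visibility record with its `7`-CONGRUENCE PROVED IN THE KERNEL (θ discharged modulo Fisher's fact `hF7r` (Thm. 4.8), through team b2b's kernel evaluator `sevenCongruent_of_twistCertificate7Rev` (`decide +kernel`))

Cell `bsd-addord`, seat `bsd-addord-k1-c2` (D-0074 row B1, crux `GordTwoRankZeroOffCaseOne` = item 19357), gen 6. HONEST FRAMING: nothing here proves the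
Birch–Swinnerton-Dyer conjecture or the crux; THEOREMS ONLY (no definition, no named fact, no `sorry`); per pair; NOT a class theorem; nothing booked.
The partner `F` of `…AdditiveBranchIMCGordTwoRankZeroCompanionRecord71148bh1` is `ℚ`-isomorphic to the member `P = (-5217520 : -847 : 3)`, `u = 8801749046654226432` of the reverse twist `X_E⁻(7) = {𝓖 = 0}` (Thm. 3.9/4.8, family (4.8) with `(𝓖, d₂)`) of `E`;
certificate found EXACTLY (rational roots of the covariant/j-condition; kit j268962, script `work/cert/job/main.py` of this seat) and checked here by
`norm_num` / `decide +kernel` on the tree's forms; the remaining binders are those of the `…_of_congr` theorems minus `θ`, `hθ` plus `hF7r`. [cite: Fisher2014SevenElevenCongruent, Thm. 4.8 with Thm. 4.6 and Thm. 3.9] [cite: MazurRubin2015SelmerCompanions, Thm. 3.1]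
-/

set_option autoImplicit false

noncomputable section

open scoped Classical

open WeierstrassCurve Literature.NumberTheory.EllipticCurves
  Literature.NumberTheory.EllipticCurves.Rank1Residual
  Literature.NumberTheory.EllipticCurves.Rank1Residual.Typed
  Literature.NumberTheory.EllipticCurves.Rank1Residual.X11RankOneCertificates
  Literature.NumberTheory.EllipticCurves.Wuthrich2014
  Literature.NumberTheory.EllipticCurves.MazurRubin2015
  Literature.NumberTheory.EllipticCurves.ModularForms
  Literature.NumberTheory.GaloisRepresentations
  Summit.BirchSwinnertonDyer.BirchSwinnertonDyer.Rank1Residual.IntModel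
  Summit.BirchSwinnertonDyer.Rank1Residual.X11b
  Summit.BirchSwinnertonDyer.Rank1Residual.GaloisImage
  Summit.BirchSwinnertonDyer.Rank1Residual.Supersingular
  Summit.BirchSwinnertonDyer.Rank1Residual.SecondDescent
open NumberField IsDedekindDomain Rat.HeightOneSpectrum Field
open Summit.BirchSwinnertonDyer.Rank1Residual.Supersingular.LocalOddTorsion

set_option linter.dupNamespace false

open Literature.NumberTheory.EllipticCurves.Fisher2014
open Summit.BirchSwinnertonDyer.Rank1Residual.Supersingular
namespace Summit.BirchSwinnertonDyer.BirchSwinnertonDyer.Theorems.AdditiveBranchIMCGordTwoRankZeroCompanion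

open Summit.BirchSwinnertonDyer.Rank1Residual
open Summit.BirchSwinnertonDyer.Rank1Residual.Additive

/-- **`ord_7 #Ш(E)_an ≤ ord_7 #Ш(E)` for `E = 71148bh1` with the `7`-congruence `F[7] ≃ E[7]` PROVED IN THE KERNEL** modulo Fisher's fact `hF7r` (Thm. 4.8), through team b2b's kernel evaluator `sevenCongruent_of_twistCertificate7Rev` (`decide +kernel`): `P = (-5217520 : -847 : 3)`, `u = 8801749046654226432` (family 2). Everything else as in
`missingLowerBoundAt_c71148bh1_7_of_congr`. Per pair; nothing booked. [cite: Fisher2014SevenElevenCongruent, Thm. 4.8 with Thm. 4.6 and Thm. 3.9] [cite: MazurRubin2015SelmerCompanions, Thm. 3.1] -/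
theorem missingLowerBoundAt_c71148bh1_7
    (hCT : exists_casselsTate_pairing (K := ℚ)) (hGZK : rank_eq_analyticRank_of_analyticRank_le_one)
    (hMRt : selmerLocalKer_iff_of_twist_of_goodReduction_above) (hF7r : thm48_sevenCongruent_twistQuartic7Rev) {W F : WeierstrassCurve ℚ}
    [W.IsElliptic] [W.IsGloballyMinimal] [F.IsElliptic] [F.IsGloballyMinimal] (hWeq : W = ⟨0, -1, 0, -1217421, -516660087⟩)
    (hFeq : F = ⟨0, -1, 0, -25692, 1813176⟩) (hr0 : W.analyticRank = 0) {q : ℚ} (hq : shaAn W = (q : ℂ)) (hv : padicValRat 7 q ≤ 2) :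
    MissingLowerBoundAt W 7 := by
  obtain ⟨θ, hθ⟩ := sevenCongruent_of_twistCertificate7Rev hF7r W F (58436224 : ℚ) (446744932480 : ℚ) (1233232 : ℚ) (-1559184704 : ℚ)
    (-5217520 : ℚ) (-847 : ℚ) (3 : ℚ) (8801749046654226432 : ℚ)
    (by subst hWeq; norm_num [WeierstrassCurve.c₄, WeierstrassCurve.b₂, WeierstrassCurve.b₄])
    (by subst hWeq; norm_num [WeierstrassCurve.c₆, WeierstrassCurve.b₂, WeierstrassCurve.b₄, WeierstrassCurve.b₆])
    (by subst hFeq; norm_num [WeierstrassCurve.c₄, WeierstrassCurve.b₂, WeierstrassCurve.b₄])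
    (by subst hFeq; norm_num [WeierstrassCurve.c₆, WeierstrassCurve.b₂, WeierstrassCurve.b₄, WeierstrassCurve.b₆])
    (by norm_num) (by norm_num) (by norm_num)
    (by decide +kernel) (by decide +kernel) (by decide +kernel) (by decide +kernel) (by decide +kernel)
  exact missingLowerBoundAt_c71148bh1_7_of_congr hCT hGZK hMRt hWeq hFeq hr0 hq hv θ hθ

/-- **`BSD(E,7)` for `E = 71148bh1` with the `7`-congruence `F[7] ≃ E[7]` PROVED IN THE KERNEL** modulo Fisher's fact `hF7r` (Thm. 4.8), through team b2b's kernel evaluator `sevenCongruent_of_twistCertificate7Rev` (`decide +kernel`): `P = (-5217520 : -847 : 3)`, `u = 8801749046654226432` (family 2). Everything else as in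
`bsdp_c71148bh1_7_of_congr`. Per pair; nothing booked. [cite: Fisher2014SevenElevenCongruent, Thm. 4.8 with Thm. 4.6 and Thm. 3.9] [cite: MazurRubin2015SelmerCompanions, Thm. 3.1] -/
theorem bsdp_c71148bh1_7
    (hCT : exists_casselsTate_pairing (K := ℚ)) (hGZK : rank_eq_analyticRank_of_analyticRank_le_one)
    (hMRt : selmerLocalKer_iff_of_twist_of_goodReduction_above) (hK : Wuthrich2014.kato_halfEigenCharIdeal_dvd_cyclotomicPrime_of_surjective)
    (hDel98 : Delbourgo1998.prop4_rankZero_pow_dvd_constantCoeff) (hPal : Pal2012.thm32_sqrt_mul_realPeriodRat_twist_eq_of_prime_one_mod_four)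
    (hmod : hasEntireLFunction_rat) (hmodD : nonempty_modularParametrizationData) (hF7r : thm48_sevenCongruent_twistQuartic7Rev)
    {W F : WeierstrassCurve ℚ} [W.IsElliptic] [W.IsGloballyMinimal] [F.IsElliptic] [F.IsGloballyMinimal] (hWeq : W = ⟨0, -1, 0, -1217421, -516660087⟩)
    (hFeq : F = ⟨0, -1, 0, -25692, 1813176⟩) (hr0 : W.analyticRank = 0) {q : ℚ} (hq : shaAn W = (q : ℂ)) (hv : padicValRat 7 q ≤ 2) :
    BSDp W 7 := by
  obtain ⟨θ, hθ⟩ := sevenCongruent_of_twistCertificate7Rev hF7r W F (58436224 : ℚ) (446744932480 : ℚ) (1233232 : ℚ) (-1559184704 : ℚ)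
    (-5217520 : ℚ) (-847 : ℚ) (3 : ℚ) (8801749046654226432 : ℚ)
    (by subst hWeq; norm_num [WeierstrassCurve.c₄, WeierstrassCurve.b₂, WeierstrassCurve.b₄])
    (by subst hWeq; norm_num [WeierstrassCurve.c₆, WeierstrassCurve.b₂, WeierstrassCurve.b₄, WeierstrassCurve.b₆])
    (by subst hFeq; norm_num [WeierstrassCurve.c₄, WeierstrassCurve.b₂, WeierstrassCurve.b₄])
    (by subst hFeq; norm_num [WeierstrassCurve.c₆, WeierstrassCurve.b₂, WeierstrassCurve.b₄, WeierstrassCurve.b₆])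
    (by norm_num) (by norm_num) (by norm_num)
    (by decide +kernel) (by decide +kernel) (by decide +kernel) (by decide +kernel) (by decide +kernel)
  exact bsdp_c71148bh1_7_of_congr hCT hGZK hMRt hK hDel98 hPal hmod hmodD hWeq hFeq hr0 hq hv θ hθ

end Summit.BirchSwinnertonDyer.BirchSwinnertonDyer.Theorems.AdditiveBranchIMCGordTwoRankZeroCompanion

end
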